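import Literature.Analysis.FluidPDE.WholeSpaceIBP
import Literature.Analysis.FunctionSpaces.WeakDerivInner
import Literature.Analysis.FunctionSpaces.MeyersSerrinProofs
import HarnessLib

/-!
# Weak derivatives along vector fields

Topic `Literature/Analysis/FluidPDE`. General-purpose infrastructure (one definition with its
calculus; everything proved, no named facts) for the regularity theory of the periodic Neumann
problem on the cylinder — the analytic input of the local existence theorem for the Euler equations
in the periodic cylinder (Kato–Lai 1984, Thm I/II; the tree's named fact
`Literature.Analysis.FluidPDE.KatoLai1984_periodicCylinderUniformExistence`). Regularity of weak
solutions up to the curved wall `{r = 1}` is obtained direction by direction: first along the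
tangential Killing fields `∂_θ = x₀∂₁ − x₁∂₀`, `∂_z` of the cylinder (difference quotients along the
symmetries), then along the radial field `x_h·∇ = r∂_r` (from the equation), and only at the end
reassembled into Cartesian derivatives. This requires a notion of **weak derivative along a single
(variable-coefficient) vector field**, intermediate between "no derivative" and the tree's weak
Fréchet derivative `HasWeakFDerivOn` (`SobolevDomain.lean`, Evans *PDE* §5.2.1):

* `HasWeakDerivAlong Ω μ X g g'` — `g, g'` locally integrable on the open set `Ω` and
  `∫_Ω (Dφ(X) + (div X) φ) • g dμ = −∫_Ω φ • g' dμ` for every real test function `φ` on `Ω`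
  (`IsTestFunctionOn`); the left factor is the formal transpose `−(X·∇)ᵗφ = X·∇φ + (div X)φ`
  (Friedrichs 1944; Hörmander, *ALPDO I*, §6.3), so that for `g` of class `C¹` the classical
  derivative `Dg(X)` is a weak one (`of_contDiffOn`).

Calculus (all proved): a.e. congruences (`congr`, `congr_deriv`); linearity in the function
(`add`, `sub`, `neg`, `const_smul`, `zero`, `finset_sum`); restriction (`mono`); post-composition
with a continuous linear map of the values (`clm_apply`); **linearity in the field** (`add_field`)
and **scaling of the field by a smooth function** (`smul_field`: `ψX` differentiates to `ψ g'`,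
since `div(ψX) = ψ div X + Dψ(X)`); the **Leibniz rule** `X(ψg) = (Xψ)g + ψ(Xg)` for smooth `ψ`
(`smul`); the **pairing with a smooth vector field** `X⟪V, w⟫ = ⟪DV(X), w⟫ + ⟪V, Xw⟫`
(`inner_smooth`); the two bridges with the tree's weak Fréchet derivative — a weak Fréchet
derivative differentiates along every smooth field, `X g = Dg(X)` (`HasWeakFDerivOn.hasWeakDerivAlong`,
expanding `X = Σᵢ ⟪bᵢ, X⟫ bᵢ` and testing with `φ⟪bᵢ, X⟫`), and conversely weak derivatives along the
vectors of an orthonormal basis assemble to a weak Fréchet derivative (`hasWeakFDerivOn_of_basis`);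
**a.e. uniqueness** (`ae_eq`, Mathlib's `IsOpen.ae_eq_zero_of_integral_contDiff_smul_eq_zero`).

## Design

The predicate is stated for any finite-dimensional real inner product space `E` (the divergence is
the tree's `VectorCalculus.divergence`, the trace of the Fréchet derivative), any measure `μ` and any
normed target `F`; the test functions are the tree's `IsTestFunctionOn Ω` (smooth, compactly
supported, `tsupport ⊆ Ω`), exactly as for `HasWeakFDerivOn`, so that the two notions interoperate.
Fields are required `C¹` (resp. smooth) globally where the calculus needs the transpose to be a test
factor; fields smooth only on `Ω` are handled by `smul_field` with a smooth extension of the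
coefficient.

## What is NOT here

Difference quotients along flows and their limits (the sequel file on the symmetries of the
cylinder); anything specific to the cylinder.

Mathlib/tree search: Mathlib has `lineDeriv` (classical directional derivatives) and distributions on
`ℝⁿ` (`Mathlib/Analysis/Distribution/`), but no weak derivative along a variable vector field on a
domain; the tree has `HasWeakFDerivOn` and its calculus (`SobolevDomainProofs`, `WeakDerivInner`:
`smul_contDiff`, `inner`, `integrableOn_smul_of_tsupport_subset`, `IsTestFunctionOn.mul_contDiff`),
`MeyersSerrin.hasWeakFDerivOn_of_contDiffOn`, `VectorCalculus.divergence` with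
`divergence_eq_sum_inner_fderiv`, `divergence_smul_apply` (`WholeSpaceIBP`) — all used here. From
Mathlib: `fderiv_of_notMem_tsupport`, `image_eq_zero_of_notMem_tsupport`, `fderiv_fun_mul`,
`fderiv_inner_apply`, `OrthonormalBasis.sum_repr'`, `OrthonormalBasis.sum_inner_mul_inner`,
`ContinuousLinearMap.integral_comp_comm`, `ContinuousLinearMap.locallyIntegrableOn_comp`,
`MeasureTheory.locallyIntegrableOn_iff`, `setIntegral_eq_of_subset_of_forall_sdiff_eq_zero`,
`setIntegral_eq_integral_of_forall_compl_eq_zero`, `IsOpen.ae_eq_zero_of_integral_contDiff_smul_eq_zero`.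

## References

* K. O. Friedrichs, *The identity of weak and strong extensions of differential operators*, Trans.
  AMS 55 (1944) 132–151 (weak first-order operators). [folklore]
* L. C. Evans, *Partial Differential Equations*, 2nd ed. (2010), §5.2.1 (weak derivatives).
  [Evans2010]
* T. Kato, C. Y. Lai, *Nonlinear evolution equations and the Euler flow*, J. Funct. Anal. 56 (1984)
  15–28 (the programme this serves). [KatoLai1984]
-/

noncomputable section

open MeasureTheory TopologicalSpace Set Function Filter Topology InnerProductSpace
open scoped RealInnerProductSpace ENNReal NNReal ContDiff

namespace Literature.Analysis.FluidPDE

open Literature.Analysis.FunctionSpaces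

-- nested operator types (`smulRightL`), as in `WeakDerivInner`
set_option maxSynthPendingDepth 3

variable {E : Type*} [NormedAddCommGroup E] [InnerProductSpace ℝ E] [MeasurableSpace E]
variable {F : Type*} [NormedAddCommGroup F] [NormedSpace ℝ F]
variable {G : Type*} [NormedAddCommGroup G] [NormedSpace ℝ G]

/-- **Weak derivative along a vector field.** `HasWeakDerivAlong Ω μ X g g'`: `g'` is a weak
derivative of `g` along the vector field `X` on the open set `Ω` — both locally integrable on `Ω`,
and for every real test function `φ` on `Ω`,
`∫_Ω (Dφ(X) + (div X) φ) • g dμ = −∫_Ω φ • g' dμ`,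
the transpose of the first-order operator `X·∇` being `−(X·∇) − div X` (Friedrichs 1944, weak and
strong extensions of differential operators; Hörmander, *ALPDO I*, §6.3; Evans, *PDE*, §5.2.1 for
constant `X = eᵢ`, where this is the `eᵢ`-component of the tree's `HasWeakFDerivOn`, see
`HasWeakFDerivOn.hasWeakDerivAlong`). [folklore] -/
structure HasWeakDerivAlong (Ω : Opens E) (μ : Measure E) (X : E → E) (g g' : E → F) : Prop where
  /-- The function is locally integrable on `Ω`. -/
  locallyIntegrableOn : LocallyIntegrableOn g (Ω : Set E) μ
  /-- The weak derivative is locally integrable on `Ω`. -/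
  locallyIntegrableOn_deriv : LocallyIntegrableOn g' (Ω : Set E) μ
  /-- Integration by parts against test functions. -/
  integral_eq : ∀ φ : E → ℝ, IsTestFunctionOn Ω φ →
    ∫ x in (Ω : Set E), (fderiv ℝ φ x (X x) + VectorCalculus.divergence X x * φ x) • g x ∂μ =
      -∫ x in (Ω : Set E), φ x • g' x ∂μ

namespace HasWeakDerivAlong

variable {Ω : Opens E} {μ : Measure E} {X Y : E → E} {g g₁ g₂ g' g₁' g₂' : E → F}

/-! ### The test factor `Dφ(X) + (div X) φ` -/

section TestFactor

omit [MeasurableSpace E]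

/-- The test factor vanishes off `tsupport φ`. [folklore] -/
theorem testFactor_eq_zero_of_notMem {φ : E → ℝ} (X : E → E) {x : E} (hx : x ∉ tsupport φ) :
    fderiv ℝ φ x (X x) + VectorCalculus.divergence X x * φ x = 0 := by
  rw [fderiv_of_notMem_tsupport ℝ hx, image_eq_zero_of_notMem_tsupport hx]
  simp

/-- The test factor has support inside `tsupport φ`. [folklore] -/
theorem tsupport_testFactor_subset (φ : E → ℝ) (X : E → E) :
    tsupport (fun x => fderiv ℝ φ x (X x) + VectorCalculus.divergence X x * φ x) ⊆ tsupport φ := by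
  refine closure_minimal (fun x hx => ?_) (isClosed_tsupport φ)
  by_contra h
  exact hx (testFactor_eq_zero_of_notMem X h)

/-- The test factor has compact support when `φ` has. [folklore] -/
theorem hasCompactSupport_testFactor {φ : E → ℝ} (hφ : HasCompactSupport φ) (X : E → E) :
    HasCompactSupport fun x => fderiv ℝ φ x (X x) + VectorCalculus.divergence X x * φ x :=
  hφ.of_isClosed_subset (isClosed_tsupport _) (tsupport_testFactor_subset φ X)

/-- The divergence of a `C¹` field is continuous (finite dimension). [folklore] -/
theorem continuous_divergence [FiniteDimensional ℝ E] (hX : ContDiff ℝ 1 X) :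
    Continuous (VectorCalculus.divergence X) := by
  have h1 : Continuous (fderiv ℝ X) := hX.continuous_fderiv one_ne_zero
  have heq : VectorCalculus.divergence X = fun x => ∑ i, ⟪stdOrthonormalBasis ℝ E i,
      fderiv ℝ X x (stdOrthonormalBasis ℝ E i)⟫ :=
    funext fun x => divergence_eq_sum_inner_fderiv (stdOrthonormalBasis ℝ E) X x
  rw [heq]
  exact continuous_finsetSum _ fun i _ => continuous_const.inner (h1.clm_apply continuous_const)

/-- The test factor is continuous when `X` is `C¹` and `φ` is a test function. [folklore] -/
theorem continuous_testFactor [FiniteDimensional ℝ E] {φ : E → ℝ} (hφ : ContDiff ℝ ∞ φ)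
    (hX : ContDiff ℝ 1 X) :
    Continuous fun x => fderiv ℝ φ x (X x) + VectorCalculus.divergence X x * φ x :=
  ((hφ.continuous_fderiv (by simp)).clm_apply hX.continuous).add
    ((continuous_divergence hX).mul hφ.continuous)

/-- The divergence is additive at points of differentiability. [folklore] -/
theorem divergence_add_apply {x : E} (hX : DifferentiableAt ℝ X x) (hY : DifferentiableAt ℝ Y x) :
    VectorCalculus.divergence (fun y => X y + Y y) x =
      VectorCalculus.divergence X x + VectorCalculus.divergence Y x := by
  simp only [VectorCalculus.divergence]
  rw [fderiv_fun_add hX hY, ContinuousLinearMap.toLinearMap_add, map_add]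

/-- `⟪u, ∇θ(x)⟫ = Dθ(x) u`. [folklore] -/
theorem inner_gradient_eq_fderiv_apply [CompleteSpace E] (θ : E → ℝ) (x u : E) :
    ⟪u, gradient θ x⟫ = fderiv ℝ θ x u := by
  rw [real_inner_comm, gradient, InnerProductSpace.toDual_symm_apply]

end TestFactor

/-! ### Integrability of the tested integrands -/

section Integrability

variable [BorelSpace E]

omit [InnerProductSpace ℝ E] in
/-- A continuous compactly supported scalar factor with support in `Ω` times a locally integrable
function is integrable on `Ω` (the tree's `integrableOn_smul_of_tsupport_subset`). [folklore] -/
theorem integrableOn_smul_aux {ψ : E → ℝ} (hψ : Continuous ψ) (hψs : HasCompactSupport ψ)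
    (hψΩ : tsupport ψ ⊆ (Ω : Set E)) {h : E → F} (hh : LocallyIntegrableOn h (Ω : Set E) μ) :
    IntegrableOn (fun x => ψ x • h x) (Ω : Set E) μ :=
  integrableOn_smul_of_tsupport_subset hψ hψs hψΩ hh

/-- Integrability of the right-hand integrand `φ • h`. [folklore] -/
theorem integrableOn_smul {φ : E → ℝ} (hφ : IsTestFunctionOn Ω φ) {h : E → F}
    (hh : LocallyIntegrableOn h (Ω : Set E) μ) :
    IntegrableOn (fun x => φ x • h x) (Ω : Set E) μ :=
  integrableOn_smul_aux hφ.contDiff.continuous hφ.hasCompactSupport hφ.tsupport_subset hh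

/-- Integrability of the left-hand integrand `(Dφ(X) + (div X) φ) • h`. [folklore] -/
theorem integrableOn_testFactor_smul [FiniteDimensional ℝ E] {φ : E → ℝ} (hφ : IsTestFunctionOn Ω φ)
    (hX : ContDiff ℝ 1 X) {h : E → F} (hh : LocallyIntegrableOn h (Ω : Set E) μ) :
    IntegrableOn (fun x => (fderiv ℝ φ x (X x) + VectorCalculus.divergence X x * φ x) • h x)
      (Ω : Set E) μ :=
  integrableOn_smul_aux (continuous_testFactor hφ.contDiff hX)
    (hasCompactSupport_testFactor hφ.hasCompactSupport X)
    ((tsupport_testFactor_subset φ X).trans hφ.tsupport_subset) hh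

end Integrability

/-! ### Algebra in the function -/

section Algebra

/-- Changing the weak derivative on a null set of `Ω`. [folklore] -/
theorem congr_deriv (h : HasWeakDerivAlong Ω μ X g g') {g'' : E → F}
    (hg'' : g' =ᵐ[μ.restrict (Ω : Set E)] g'') : HasWeakDerivAlong Ω μ X g g'' where
  locallyIntegrableOn := h.locallyIntegrableOn
  locallyIntegrableOn_deriv := h.locallyIntegrableOn_deriv.congr hg''
  integral_eq φ hφ := by
    rw [h.integral_eq φ hφ]
    congr 1
    exact integral_congr_ae (by filter_upwards [hg''] with x hx; rw [hx])

/-- Changing the function on a null set of `Ω`. [folklore] -/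
theorem congr (h : HasWeakDerivAlong Ω μ X g g') {g₀ : E → F}
    (hg₀ : g =ᵐ[μ.restrict (Ω : Set E)] g₀) : HasWeakDerivAlong Ω μ X g₀ g' where
  locallyIntegrableOn := h.locallyIntegrableOn.congr hg₀
  locallyIntegrableOn_deriv := h.locallyIntegrableOn_deriv
  integral_eq φ hφ := by
    rw [← h.integral_eq φ hφ]
    exact integral_congr_ae (by filter_upwards [hg₀] with x hx; rw [hx])

/-- Scalar multiples. [folklore] -/
theorem const_smul (h : HasWeakDerivAlong Ω μ X g g') (c : ℝ) :
    HasWeakDerivAlong Ω μ X (fun x => c • g x) (fun x => c • g' x) where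
  locallyIntegrableOn := h.locallyIntegrableOn.smul c
  locallyIntegrableOn_deriv := h.locallyIntegrableOn_deriv.smul c
  integral_eq φ hφ := by
    simp only [smul_comm _ c, integral_smul, h.integral_eq φ hφ, smul_neg]

/-- Negatives. [folklore] -/
theorem neg (h : HasWeakDerivAlong Ω μ X g g') :
    HasWeakDerivAlong Ω μ X (fun x => -g x) (fun x => -g' x) := by
  have := h.const_smul (-1)
  simpa using this

/-- The zero function has weak derivative zero along any field. [folklore] -/
theorem zero : HasWeakDerivAlong Ω μ X (fun _ => (0 : F)) (fun _ => (0 : F)) where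
  locallyIntegrableOn := locallyIntegrableOn_zero
  locallyIntegrableOn_deriv := locallyIntegrableOn_zero
  integral_eq φ hφ := by simp

variable [BorelSpace E]

/-- Restriction to a smaller open set. [folklore] -/
theorem mono (h : HasWeakDerivAlong Ω μ X g g') {Ω' : Opens E} (hΩ' : Ω' ≤ Ω) :
    HasWeakDerivAlong Ω' μ X g g' where
  locallyIntegrableOn := h.locallyIntegrableOn.mono_set hΩ'
  locallyIntegrableOn_deriv := h.locallyIntegrableOn_deriv.mono_set hΩ'
  integral_eq φ hφ := by
    have key := h.integral_eq φ (hφ.mono hΩ')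
    have h1 : ∫ x in (Ω : Set E), (fderiv ℝ φ x (X x) + VectorCalculus.divergence X x * φ x) • g x ∂μ =
        ∫ x in (Ω' : Set E), (fderiv ℝ φ x (X x) + VectorCalculus.divergence X x * φ x) • g x ∂μ := by
      refine setIntegral_eq_of_subset_of_forall_sdiff_eq_zero Ω.isOpen.measurableSet hΩ' ?_
      intro x hx
      rw [testFactor_eq_zero_of_notMem X (fun h => hx.2 (hφ.tsupport_subset h)), zero_smul]
    have h2 : ∫ x in (Ω : Set E), φ x • g' x ∂μ = ∫ x in (Ω' : Set E), φ x • g' x ∂μ := by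
      refine setIntegral_eq_of_subset_of_forall_sdiff_eq_zero Ω.isOpen.measurableSet hΩ' ?_
      intro x hx
      rw [image_eq_zero_of_notMem_tsupport (fun h => hx.2 (hφ.tsupport_subset h)), zero_smul]
    rw [← h1, ← h2, key]

variable [FiniteDimensional ℝ E]

/-- Sums. [folklore] -/
theorem add (hX : ContDiff ℝ 1 X) (h₁ : HasWeakDerivAlong Ω μ X g₁ g₁')
    (h₂ : HasWeakDerivAlong Ω μ X g₂ g₂') :
    HasWeakDerivAlong Ω μ X (fun x => g₁ x + g₂ x) (fun x => g₁' x + g₂' x) where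
  locallyIntegrableOn := h₁.locallyIntegrableOn.add h₂.locallyIntegrableOn
  locallyIntegrableOn_deriv := h₁.locallyIntegrableOn_deriv.add h₂.locallyIntegrableOn_deriv
  integral_eq φ hφ := by
    simp only [smul_add]
    rw [integral_add (integrableOn_testFactor_smul hφ hX h₁.locallyIntegrableOn)
      (integrableOn_testFactor_smul hφ hX h₂.locallyIntegrableOn),
      integral_add (integrableOn_smul hφ h₁.locallyIntegrableOn_deriv)
      (integrableOn_smul hφ h₂.locallyIntegrableOn_deriv), h₁.integral_eq φ hφ, h₂.integral_eq φ hφ,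
      neg_add]

/-- Differences. [folklore] -/
theorem sub (hX : ContDiff ℝ 1 X) (h₁ : HasWeakDerivAlong Ω μ X g₁ g₁')
    (h₂ : HasWeakDerivAlong Ω μ X g₂ g₂') :
    HasWeakDerivAlong Ω μ X (fun x => g₁ x - g₂ x) (fun x => g₁' x - g₂' x) := by
  have := h₁.add hX h₂.neg
  simpa [sub_eq_add_neg] using this

/-- Applying a continuous linear map to the values. [folklore] -/
theorem clm_apply [CompleteSpace F] [CompleteSpace G] (hX : ContDiff ℝ 1 X)
    (h : HasWeakDerivAlong Ω μ X g g') (ℓ : F →L[ℝ] G) :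
    HasWeakDerivAlong Ω μ X (fun x => ℓ (g x)) (fun x => ℓ (g' x)) where
  locallyIntegrableOn := ℓ.locallyIntegrableOn_comp h.locallyIntegrableOn
  locallyIntegrableOn_deriv := ℓ.locallyIntegrableOn_comp h.locallyIntegrableOn_deriv
  integral_eq φ hφ := by
    have key := congr_arg ℓ (h.integral_eq φ hφ)
    rw [← ℓ.integral_comp_comm (integrableOn_testFactor_smul hφ hX h.locallyIntegrableOn),
      map_neg, ← ℓ.integral_comp_comm (integrableOn_smul hφ h.locallyIntegrableOn_deriv)] at key
    simp only [map_smul] at key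
    exact key

/-! ### Algebra in the field -/

/-- **Adding fields**: weak derivatives along `X` and `Y` add to one along `X + Y`. [folklore] -/
theorem add_field (hX : ContDiff ℝ 1 X) (hY : ContDiff ℝ 1 Y) (h₁ : HasWeakDerivAlong Ω μ X g g₁')
    (h₂ : HasWeakDerivAlong Ω μ Y g g₂') :
    HasWeakDerivAlong Ω μ (fun x => X x + Y x) g (fun x => g₁' x + g₂' x) where
  locallyIntegrableOn := h₁.locallyIntegrableOn
  locallyIntegrableOn_deriv := h₁.locallyIntegrableOn_deriv.add h₂.locallyIntegrableOn_deriv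
  integral_eq φ hφ := by
    have hsplit : ∀ x, (fderiv ℝ φ x (X x + Y x) +
        VectorCalculus.divergence (fun y => X y + Y y) x * φ x) • g x =
        (fderiv ℝ φ x (X x) + VectorCalculus.divergence X x * φ x) • g x +
          (fderiv ℝ φ x (Y x) + VectorCalculus.divergence Y x * φ x) • g x := fun x => by
      rw [divergence_add_apply (hX.differentiable one_ne_zero x) (hY.differentiable one_ne_zero x),
        map_add, ← add_smul]
      ring_nf
    simp_rw [hsplit, smul_add]
    rw [integral_add (integrableOn_testFactor_smul hφ hX h₁.locallyIntegrableOn)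
      (integrableOn_testFactor_smul hφ hY h₂.locallyIntegrableOn),
      integral_add (integrableOn_smul hφ h₁.locallyIntegrableOn_deriv)
      (integrableOn_smul hφ h₂.locallyIntegrableOn_deriv), h₁.integral_eq φ hφ, h₂.integral_eq φ hφ,
      neg_add]

/-- **Scaling the field by a smooth function**: a weak derivative `g'` along `X` gives the weak
derivative `ψ g'` along `ψ X` (`div(ψX) = ψ div X + Dψ(X)`; test with `φψ`). [folklore] -/
theorem smul_field (hX : ContDiff ℝ 1 X) (h : HasWeakDerivAlong Ω μ X g g') {ψ : E → ℝ}
    (hψ : ContDiff ℝ ∞ ψ) :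
    HasWeakDerivAlong Ω μ (fun x => ψ x • X x) g (fun x => ψ x • g' x) where
  locallyIntegrableOn := h.locallyIntegrableOn
  locallyIntegrableOn_deriv :=
    h.locallyIntegrableOn_deriv.continuousOn_smul Ω.isOpen.isLocallyClosed hψ.continuous.continuousOn
  integral_eq φ hφ := by
    haveI : CompleteSpace E := FiniteDimensional.complete ℝ E
    have hφψ : IsTestFunctionOn Ω fun x => φ x * ψ x := hφ.mul_contDiff hψ
    have key := h.integral_eq _ hφψ
    have hφd : Differentiable ℝ φ := hφ.contDiff.differentiable (by simp)
    have hψd : Differentiable ℝ ψ := hψ.differentiable (by simp)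
    have hXd : Differentiable ℝ X := hX.differentiable one_ne_zero
    have hpt : ∀ x, (fderiv ℝ φ x (ψ x • X x) +
        VectorCalculus.divergence (fun y => ψ y • X y) x * φ x) • g x =
        (fderiv ℝ (fun y => φ y * ψ y) x (X x) +
          VectorCalculus.divergence X x * (φ x * ψ x)) • g x := fun x => by
      rw [divergence_smul_apply (hψd x) (hXd x), inner_gradient_eq_fderiv_apply,
        fderiv_fun_mul (hφd x) (hψd x), map_smul]
      congr 1
      simp only [_root_.add_apply, _root_.FunLike.coe_smul, Pi.smul_apply,
        smul_eq_mul]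
      ring
    simp_rw [hpt, key, smul_smul]

/-- **Leibniz rule in the function**: for `ψ` smooth, `ψ g` has weak derivative `Dψ(X) g + ψ g'`
along `X` (test with `φψ`). [folklore] -/
theorem smul (hX : ContDiff ℝ 1 X) (h : HasWeakDerivAlong Ω μ X g g') {ψ : E → ℝ}
    (hψ : ContDiff ℝ ∞ ψ) :
    HasWeakDerivAlong Ω μ X (fun x => ψ x • g x)
      (fun x => (fderiv ℝ ψ x (X x)) • g x + ψ x • g' x) where
  locallyIntegrableOn :=
    h.locallyIntegrableOn.continuousOn_smul Ω.isOpen.isLocallyClosed hψ.continuous.continuousOn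
  locallyIntegrableOn_deriv := by
    refine LocallyIntegrableOn.add ?_
      (h.locallyIntegrableOn_deriv.continuousOn_smul Ω.isOpen.isLocallyClosed hψ.continuous.continuousOn)
    exact h.locallyIntegrableOn.continuousOn_smul Ω.isOpen.isLocallyClosed
      (((hψ.continuous_fderiv (by simp)).clm_apply hX.continuous)).continuousOn
  integral_eq φ hφ := by
    have hφψ : IsTestFunctionOn Ω fun x => φ x * ψ x := hφ.mul_contDiff hψ
    have key := h.integral_eq _ hφψ
    have hφd : Differentiable ℝ φ := hφ.contDiff.differentiable (by simp)
    have hψd : Differentiable ℝ ψ := hψ.differentiable (by simp)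
    -- integrability of the pieces
    have hψ'c : Continuous fun x => fderiv ℝ ψ x (X x) :=
      (hψ.continuous_fderiv (by simp)).clm_apply hX.continuous
    have hli₁ : LocallyIntegrableOn (fun x => ψ x • g x) (Ω : Set E) μ :=
      h.locallyIntegrableOn.continuousOn_smul Ω.isOpen.isLocallyClosed hψ.continuous.continuousOn
    have hli₂ : LocallyIntegrableOn (fun x => (fderiv ℝ ψ x (X x)) • g x) (Ω : Set E) μ :=
      h.locallyIntegrableOn.continuousOn_smul Ω.isOpen.isLocallyClosed hψ'c.continuousOn
    have hli₃ : LocallyIntegrableOn (fun x => ψ x • g' x) (Ω : Set E) μ :=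
      h.locallyIntegrableOn_deriv.continuousOn_smul Ω.isOpen.isLocallyClosed hψ.continuous.continuousOn
    have I1 := integrableOn_testFactor_smul hφ hX hli₁
    have I2 := integrableOn_smul hφ hli₂
    have I3 := integrableOn_smul hφ hli₃
    -- pointwise expansion of the tested identity for `φψ`
    have hpt : ∀ x, (fderiv ℝ (fun y => φ y * ψ y) x (X x) +
        VectorCalculus.divergence X x * (φ x * ψ x)) • g x =
        (fderiv ℝ φ x (X x) + VectorCalculus.divergence X x * φ x) • (ψ x • g x) +
          φ x • ((fderiv ℝ ψ x (X x)) • g x) := fun x => by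
      rw [fderiv_fun_mul (hφd x) (hψd x)]
      simp only [_root_.add_apply, _root_.FunLike.coe_smul, Pi.smul_apply,
        smul_eq_mul, smul_smul, ← add_smul]
      ring_nf
    simp_rw [hpt] at key
    rw [integral_add I1 I2] at key
    simp_rw [smul_add]
    rw [integral_add I2 I3]
    have hrhs : ∫ x in (Ω : Set E), (φ x * ψ x) • g' x ∂μ = ∫ x in (Ω : Set E), φ x • ψ x • g' x ∂μ :=
      integral_congr_ae (Eventually.of_forall fun x => by simp only [smul_smul])
    rw [hrhs] at key
    linear_combination (norm := abel_nf) key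

end Algebra

/-! ### Finite sums -/

section Sums

variable [BorelSpace E] [FiniteDimensional ℝ E]

/-- Finite sums. [folklore] -/
theorem finset_sum (hX : ContDiff ℝ 1 X) {ι : Type*} (s : Finset ι) {f f' : ι → E → F}
    (h : ∀ i ∈ s, HasWeakDerivAlong Ω μ X (f i) (f' i)) :
    HasWeakDerivAlong Ω μ X (fun x => ∑ i ∈ s, f i x) (fun x => ∑ i ∈ s, f' i x) := by
  classical
  induction s using Finset.induction_on with
  | empty => simpa using (zero : HasWeakDerivAlong Ω μ X (fun _ => (0 : F)) fun _ => 0)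
  | insert i s hi ih =>
    simp only [Finset.sum_insert hi]
    exact (h i (Finset.mem_insert_self i s)).add hX (ih fun j hj => h j (Finset.mem_insert_of_mem hj))

end Sums

/-! ### From the weak Fréchet derivative: smooth fields, smooth functions -/

section Frechet

variable [BorelSpace E] [FiniteDimensional ℝ E]

omit [InnerProductSpace ℝ E] [BorelSpace E] [FiniteDimensional ℝ E] [NormedAddCommGroup E]
  [NormedSpace ℝ F] in
/-- Finite sums of locally integrable functions are locally integrable. [folklore] -/
theorem _root_.Literature.Analysis.FluidPDE.locallyIntegrableOn_finsetSum {Y : Type*} [TopologicalSpace Y]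
    [MeasurableSpace Y] {ν : Measure Y}
    {s₀ : Set Y} {ι : Type*} (s : Finset ι) {f : ι → Y → F}
    (hf : ∀ i ∈ s, LocallyIntegrableOn (f i) s₀ ν) :
    LocallyIntegrableOn (fun x => ∑ i ∈ s, f i x) s₀ ν := by
  classical
  induction s using Finset.induction_on with
  | empty => simpa using (locallyIntegrableOn_zero : LocallyIntegrableOn (fun _ : Y => (0 : F)) s₀ ν)
  | insert i s hi ih =>
    simp only [Finset.sum_insert hi]
    exact (hf i (Finset.mem_insert_self i s)).add (ih fun j hj => hf j (Finset.mem_insert_of_mem hj))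

omit [MeasurableSpace E] [BorelSpace E] [FiniteDimensional ℝ E] in
/-- A constant field is divergence free. [folklore] -/
theorem divergence_const_field (c : E) (x : E) : VectorCalculus.divergence (fun _ : E => c) x = 0 := by
  simp [VectorCalculus.divergence]

/-- Local integrability of `x ↦ Dg(x)(X x)` for a locally integrable operator field `Dg` and a
continuous vector field `X`. [folklore] -/
theorem locallyIntegrableOn_clm_apply_of_continuous {Dg : E → E →L[ℝ] F}
    (hDg : LocallyIntegrableOn Dg (Ω : Set E) μ) (hX : Continuous X) :
    LocallyIntegrableOn (fun x => Dg x (X x)) (Ω : Set E) μ := by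
  have hΩlc : IsLocallyClosed (Ω : Set E) := Ω.isOpen.isLocallyClosed
  rw [MeasureTheory.locallyIntegrableOn_iff hΩlc] at hDg ⊢
  intro K hK hKc
  have hDgK := hDg K hK hKc
  obtain ⟨C, hC⟩ := hKc.exists_bound_of_continuousOn hX.continuousOn
  refine Integrable.mono' (hDgK.norm.mul_const C) ?_ ?_
  · exact isBoundedBilinearMap_apply.continuous.comp_aestronglyMeasurable
      (hDgK.aestronglyMeasurable.prodMk hX.aestronglyMeasurable.restrict)
  · filter_upwards [ae_restrict_mem hKc.measurableSet] with x hx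
    calc ‖Dg x (X x)‖ ≤ ‖Dg x‖ * ‖X x‖ := ContinuousLinearMap.le_opNorm _ _
      _ ≤ ‖Dg x‖ * C := by gcongr; exact hC x hx

/-- **A weak Fréchet derivative differentiates weakly along every smooth field**: if `Dg` is a weak
derivative of `g` on `Ω` (the tree's `HasWeakFDerivOn`) and `X` is a smooth vector field, then
`x ↦ Dg(x)(X x)` is a weak derivative of `g` along `X` — expand `X = Σᵢ ⟪bᵢ, X⟫ bᵢ` in an orthonormal
basis and test the `bᵢ`-identity with the test functions `φ ⟪bᵢ, X⟫`. [folklore] -/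
theorem _root_.Literature.Analysis.FunctionSpaces.HasWeakFDerivOn.hasWeakDerivAlong {g : E → F}
    {Dg : E → E →L[ℝ] F} (h : HasWeakFDerivOn Ω μ g Dg) (hX : ContDiff ℝ ∞ X) :
    HasWeakDerivAlong Ω μ X g (fun x => Dg x (X x)) where
  locallyIntegrableOn := h.locallyIntegrableOn
  locallyIntegrableOn_deriv :=
    locallyIntegrableOn_clm_apply_of_continuous h.locallyIntegrableOn_deriv hX.continuous
  integral_eq φ hφ := by
    set b := stdOrthonormalBasis ℝ E with hb
    have hX1 : ContDiff ℝ 1 X := hX.of_le (by exact_mod_cast le_top)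
    have hXd : Differentiable ℝ X := hX1.differentiable one_ne_zero
    have hφd : Differentiable ℝ φ := hφ.contDiff.differentiable (by simp)
    -- the coefficient functions `cᵢ = ⟪bᵢ, X⟫` and the test functions `φ cᵢ`
    have hc : ∀ i, ContDiff ℝ ∞ fun x => ⟪b i, X x⟫ := fun i => contDiff_const.inner ℝ hX
    have hcd : ∀ i, Differentiable ℝ fun x => ⟪b i, X x⟫ := fun i => (hc i).differentiable (by simp)
    have hψ : ∀ i, IsTestFunctionOn Ω fun x => φ x * ⟪b i, X x⟫ := fun i => hφ.mul_contDiff (hc i)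
    have hDc : ∀ i x, fderiv ℝ (fun x => ⟪b i, X x⟫) x (b i) = ⟪b i, fderiv ℝ X x (b i)⟫ := fun i x => by
      rw [fderiv_inner_apply ℝ (differentiableAt_const _) (hXd x)]
      simp
    have key : ∀ i, ∫ x in (Ω : Set E), (fderiv ℝ (fun x => φ x * ⟪b i, X x⟫) x (b i)) • g x ∂μ =
        -∫ x in (Ω : Set E), (φ x * ⟪b i, X x⟫) • Dg x (b i) ∂μ := fun i =>
      h.integral_fderiv_smul_eq _ (b i) (hψ i)
    -- pointwise: the sum of the tested `bᵢ`-integrands is the tested `X`-integrand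
    have hlhs : ∀ x, (fderiv ℝ φ x (X x) + VectorCalculus.divergence X x * φ x) • g x =
        ∑ i, (fderiv ℝ (fun x => φ x * ⟪b i, X x⟫) x (b i)) • g x := fun x => by
      rw [← Finset.sum_smul]
      congr 1
      have hexp : fderiv ℝ φ x (X x) = ∑ i, fderiv ℝ φ x (b i) * ⟪b i, X x⟫ := by
        conv_lhs => rw [← b.sum_repr' (X x)]
        rw [map_sum]
        refine Finset.sum_congr rfl fun i _ => ?_
        rw [map_smul, smul_eq_mul, mul_comm]
      rw [hexp, divergence_eq_sum_inner_fderiv b, Finset.sum_mul, ← Finset.sum_add_distrib]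
      refine Finset.sum_congr rfl fun i _ => ?_
      rw [fderiv_fun_mul (hφd x) (hcd i x)]
      simp only [_root_.add_apply, _root_.FunLike.coe_smul, Pi.smul_apply, smul_eq_mul, hDc]
      ring
    have hrhs : ∀ x, φ x • Dg x (X x) = ∑ i, (φ x * ⟪b i, X x⟫) • Dg x (b i) := fun x => by
      conv_lhs => rw [← b.sum_repr' (X x)]
      rw [map_sum, Finset.smul_sum]
      refine Finset.sum_congr rfl fun i _ => ?_
      rw [map_smul, smul_smul]
    simp_rw [hlhs, hrhs]
    -- integrability of each summand
    have I1 : ∀ i, IntegrableOn (fun x => (fderiv ℝ (fun x => φ x * ⟪b i, X x⟫) x (b i)) • g x)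
        (Ω : Set E) μ := fun i => by
      have hti := hψ i
      exact integrableOn_smul_aux ((hti.contDiff.continuous_fderiv (by simp)).clm_apply continuous_const)
        (hti.hasCompactSupport.fderiv_apply (𝕜 := ℝ) (b i))
        ((tsupport_fderiv_apply_subset ℝ (b i)).trans hti.tsupport_subset) h.locallyIntegrableOn
    have I2 : ∀ i, IntegrableOn (fun x => (φ x * ⟪b i, X x⟫) • Dg x (b i)) (Ω : Set E) μ := fun i =>
      integrableOn_smul (hψ i) (locallyIntegrableOn_clm_apply_of_continuous h.locallyIntegrableOn_deriv
        continuous_const)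
    rw [integral_finsetSum _ fun i _ => I1 i, integral_finsetSum _ fun i _ => I2 i, ← Finset.sum_neg_distrib]
    exact Finset.sum_congr rfl fun i _ => key i

/-- **Smooth functions differentiate weakly along smooth fields with the classical derivative**
(on an additive Haar measure): `x ↦ Dg(x)(X x)` is a weak derivative of `g` along `X` on `Ω` for `g`
smooth on `Ω`. [folklore] -/
theorem of_contDiffOn [μ.IsAddHaarMeasure] {g : E → F} (hg : ContDiffOn ℝ ∞ g (Ω : Set E))
    (hX : ContDiff ℝ ∞ X) : HasWeakDerivAlong Ω μ X g (fun x => fderiv ℝ g x (X x)) :=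
  (MeyersSerrin.hasWeakFDerivOn_of_contDiffOn (μ := μ) hg).hasWeakDerivAlong hX

omit [FiniteDimensional ℝ E] in
/-- **From weak derivatives along a basis to the weak Fréchet derivative**: if `gᵢ` is a weak
derivative of `g` along the constant field `bᵢ` for every vector of an orthonormal basis `b`, then
`v ↦ Σᵢ ⟪bᵢ, v⟫ gᵢ(x)` is a weak Fréchet derivative of `g` on `Ω`. [folklore] -/
theorem hasWeakFDerivOn_of_basis {ι : Type*} [Fintype ι] (b : OrthonormalBasis ι ℝ E) {g : E → F}
    {gᵢ : ι → E → F} (h : ∀ i, HasWeakDerivAlong Ω μ (fun _ => b i) g (gᵢ i)) (i₀ : ι) :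
    HasWeakFDerivOn Ω μ g (fun x => ∑ i, (innerSL ℝ (b i)).smulRight (gᵢ i x)) where
  locallyIntegrableOn := (h i₀).locallyIntegrableOn
  locallyIntegrableOn_deriv := by
    have hterm : ∀ i, LocallyIntegrableOn (fun x => (innerSL ℝ (b i)).smulRight (gᵢ i x)) (Ω : Set E) μ :=
      fun i => (ContinuousLinearMap.smulRightL ℝ E F (innerSL ℝ (b i))).locallyIntegrableOn_comp
        (h i).locallyIntegrableOn_deriv
    exact locallyIntegrableOn_finsetSum _ fun i _ => hterm i
  integral_fderiv_smul_eq φ v hφ := by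
    have hφd : Differentiable ℝ φ := hφ.contDiff.differentiable (by simp)
    -- `Dφ v = Σᵢ ⟪bᵢ, v⟫ Dφ bᵢ` and `div bᵢ = 0`
    have key : ∀ i, ∫ x in (Ω : Set E), (fderiv ℝ φ x (b i)) • g x ∂μ =
        -∫ x in (Ω : Set E), φ x • gᵢ i x ∂μ := fun i => by
      have := (h i).integral_eq φ hφ
      simpa [divergence_const_field] using this
    have hlhs : ∀ x, (fderiv ℝ φ x v) • g x = ∑ i, ⟪b i, v⟫ • ((fderiv ℝ φ x (b i)) • g x) := fun x => by
      conv_lhs => rw [← b.sum_repr' v]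
      rw [map_sum, Finset.sum_smul]
      refine Finset.sum_congr rfl fun i _ => ?_
      rw [map_smul, smul_assoc]
    have hrhs : ∀ x, φ x • (∑ i, (innerSL ℝ (b i)).smulRight (gᵢ i x)) v =
        ∑ i, ⟪b i, v⟫ • (φ x • gᵢ i x) := fun x => by
      rw [FunLike.coe_sum, Finset.sum_apply, Finset.smul_sum]
      refine Finset.sum_congr rfl fun i _ => ?_
      rw [ContinuousLinearMap.smulRight_apply, innerSL_apply_apply, smul_comm]
    simp_rw [hlhs, hrhs]
    have I1 : ∀ i, IntegrableOn (fun x => (fderiv ℝ φ x (b i)) • g x) (Ω : Set E) μ := fun i =>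
      integrableOn_smul_aux ((hφ.contDiff.continuous_fderiv (by simp)).clm_apply continuous_const)
        (hφ.hasCompactSupport.fderiv_apply (𝕜 := ℝ) (b i))
        ((tsupport_fderiv_apply_subset ℝ (b i)).trans hφ.tsupport_subset) (h i).locallyIntegrableOn
    have I2 : ∀ i, IntegrableOn (fun x => φ x • gᵢ i x) (Ω : Set E) μ := fun i =>
      integrableOn_smul hφ (h i).locallyIntegrableOn_deriv
    have I1' : ∀ i, IntegrableOn (fun x => ⟪b i, v⟫ • ((fderiv ℝ φ x (b i)) • g x)) (Ω : Set E) μ :=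
      fun i => (I1 i).smul _
    have I2' : ∀ i, IntegrableOn (fun x => ⟪b i, v⟫ • (φ x • gᵢ i x)) (Ω : Set E) μ :=
      fun i => (I2 i).smul _
    rw [integral_finsetSum _ fun i _ => I1' i, integral_finsetSum _ fun i _ => I2' i,
      ← Finset.sum_neg_distrib]
    refine Finset.sum_congr rfl fun i _ => ?_
    rw [integral_smul, integral_smul, key i, smul_neg]

end Frechet

/-! ### Uniqueness -/

section Unique

variable [BorelSpace E] [FiniteDimensional ℝ E]

/-- **Weak derivatives along a field are unique a.e. on `Ω`.** [folklore] -/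
theorem ae_eq [CompleteSpace F] (h₁ : HasWeakDerivAlong Ω μ X g g₁') (h₂ : HasWeakDerivAlong Ω μ X g g₂') :
    g₁' =ᵐ[μ.restrict (Ω : Set E)] g₂' := by
  have hd : LocallyIntegrableOn (fun x => g₁' x - g₂' x) (Ω : Set E) μ :=
    h₁.locallyIntegrableOn_deriv.sub h₂.locallyIntegrableOn_deriv
  have hz := Ω.isOpen.ae_eq_zero_of_integral_contDiff_smul_eq_zero hd ?_
  · rw [Filter.EventuallyEq, ae_restrict_iff' Ω.isOpen.measurableSet]
    filter_upwards [hz] with x hx hxΩ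
    exact sub_eq_zero.1 (hx hxΩ)
  intro φ hφ hφc hφs
  have hφt : IsTestFunctionOn Ω φ := ⟨hφ, hφc, hφs⟩
  have e₁ := h₁.integral_eq φ hφt
  have e₂ := h₂.integral_eq φ hφt
  have I1 := integrableOn_smul hφt h₁.locallyIntegrableOn_deriv
  have I2 := integrableOn_smul hφt h₂.locallyIntegrableOn_deriv
  -- the integral over the whole space is the integral over `Ω`
  have hsupp : support (fun x => φ x • (g₁' x - g₂' x)) ⊆ (Ω : Set E) := fun x hx => by
    apply hφs
    apply subset_tsupport
    exact fun h0 => hx (by simp [h0])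
  rw [← setIntegral_eq_integral_of_forall_compl_eq_zero fun x hx => ?_]
  · simp_rw [smul_sub]
    rw [integral_sub I1 I2, sub_eq_zero]
    exact neg_injective (e₁.symm.trans e₂)
  · by_contra hne
    exact hx (hsupp hne)

end Unique

/-! ### Inner products with smooth vector fields -/

section Inner

variable [BorelSpace E] [FiniteDimensional ℝ E]
variable {H : Type*} [NormedAddCommGroup H] [InnerProductSpace ℝ H] [CompleteSpace H]

/-- **The pairing with a smooth field**: if `w'` is a weak derivative of the `H`-valued `w` along
`X` and `V : E → H` is smooth, then `x ↦ ⟪V x, w x⟫` has the weak derivative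
`⟪DV(x)(X x), w x⟫ + ⟪V x, w' x⟫` along `X`. [folklore] -/
theorem inner_smooth [FiniteDimensional ℝ H] (hX : ContDiff ℝ ∞ X) {w w' : E → H}
    (h : HasWeakDerivAlong Ω μ X w w') {V : E → H} (hV : ContDiff ℝ ∞ V) :
    HasWeakDerivAlong Ω μ X (fun x => ⟪V x, w x⟫)
      (fun x => ⟪fderiv ℝ V x (X x), w x⟫ + ⟪V x, w' x⟫) := by
  have hX1 : ContDiff ℝ 1 X := hX.of_le (by exact_mod_cast le_top)
  set b := stdOrthonormalBasis ℝ H with hb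
  -- components
  have hVi : ∀ i, ContDiff ℝ ∞ fun x => ⟪b i, V x⟫ := fun i => contDiff_const.inner ℝ hV
  have hwi : ∀ i, HasWeakDerivAlong Ω μ X (fun x => ⟪b i, w x⟫) (fun x => ⟪b i, w' x⟫) := fun i => by
    have := h.clm_apply hX1 (innerSL ℝ (b i))
    simpa only [innerSL_apply_apply] using this
  have hprod : ∀ i, HasWeakDerivAlong Ω μ X (fun x => ⟪b i, V x⟫ • ⟪b i, w x⟫)
      (fun x => (fderiv ℝ (fun x => ⟪b i, V x⟫) x (X x)) • ⟪b i, w x⟫ + ⟪b i, V x⟫ • ⟪b i, w' x⟫) :=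
    fun i => (hwi i).smul hX1 (hVi i)
  have hsum := finset_sum hX1 Finset.univ (fun i _ => hprod i)
  have hVd : Differentiable ℝ V := hV.differentiable (by simp)
  have hDVi : ∀ i x, fderiv ℝ (fun x => ⟪b i, V x⟫) x (X x) = ⟪b i, fderiv ℝ V x (X x)⟫ := fun i x => by
    rw [fderiv_inner_apply ℝ (differentiableAt_const _) (hVd x)]
    simp
  have hpair : ∀ p q : H, ∑ i, ⟪b i, p⟫ * ⟪b i, q⟫ = ⟪p, q⟫ := fun p q => by
    rw [← b.sum_inner_mul_inner p q]
    exact Finset.sum_congr rfl fun i _ => by rw [real_inner_comm (b i) p]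
  refine (hsum.congr (Eventually.of_forall fun x => ?_)).congr_deriv (Eventually.of_forall fun x => ?_)
  · simp only [smul_eq_mul]
    exact hpair (V x) (w x)
  · simp only [smul_eq_mul, hDVi, Finset.sum_add_distrib]
    rw [hpair, hpair]

end Inner

end HasWeakDerivAlong

end Literature.Analysis.FluidPDE
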